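import Summits.RiemannHypothesis.RiemannHypothesis.Theorems.Splittings.NbSparsity
import HarnessLib

/-!
# RH-EQUIVALENT·SPLITTING CENSUS (nb, neg) · V35 «SPARSE», part 2: stability — ℓ¹-NEAR-sparse Nyman–Beurling approximants are refuted too; nothing here bears on the truth of RH

LABEL (line 1): RH-EQUIVALENT·SPLITTING (cell `rh-split`, seat (nb, neg), generation 10, census
candidate V35, part 2 of 2; part 1 = `Splittings.NbSparsity`).  Part 1 refutes EXACT sparsity
(`not_nbSparseApprox`: at most `B` nonzero coefficients), a closed, measure-zero condition on the
coefficient vector.  Here the refutation is made an OPEN condition: the conjunct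
«NEAR-SPARSE(B)» — *for every `ε > 0` some Dirichlet polynomial whose coefficient mass OUTSIDE some
`B`-set is `< ε` has `I(N,a) < ε`* — is refuted for every `B` (`not_nbNearSparseApprox`,
`nbNearSparse_floor`): the coefficient mass of near-optimal Nyman–Beurling approximants cannot
concentrate, up to an ℓ¹-small remainder, on boundedly many terms.  UNCONDITIONAL; inputs = part 1
+ the tree's all-`t` critical-line bound `‖ζ(1/2+it)‖ ≤ 8(1+|t|)^{1/4}`
(`Theorems.norm_riemannZeta_half_line_le_eight_mul_rpow`, Lehman/Trudgian, a discharged fact) and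
the integrable majorant `Theorems.integrable_nbMajorant`.  Still NO zero of `ζ` is used.

## The argument

`1 - ζA' = (1 - ζA) + ζ(A - A')` and `‖A - A'‖ ≤ τ := Σ‖a_n - a'_n‖` on `Re s ≥ 0`, so pointwise
`‖1-ζA'‖²/w ≤ 2‖1-ζA‖²/w + 2τ²(1+8(1+|t|)^{1/4})²/w` (`nbIntegrand_perturb_le`, `w = 1/4+t²`);
integrating, `I(a') ≤ 2I(a) + 2τ²K`, `K = ∫(1+8(1+|t|)^{1/4})²/(1/4+t²) dt < ∞`
(`nb_lintegral_perturb_le`).  Truncating a near-sparse approximant to its `B`-set therefore produces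
an exactly `B`-sparse one with small integral, contradicting part 1.

Zero definitions; the E_NB integrand is the route's, verbatim.  Standard axioms only.

HONEST LABEL: «SPLITTING SEARCH over kernel-typed RH-EQUIVALENCES; a splitting A ∧ B ⟹ RH is
CONDITIONAL bookkeeping unless A and B are both proved; nothing here bears on the truth of RH.»
-/

set_option linter.dupNamespace false

noncomputable section

open Complex MeasureTheory Filter Topology

namespace Summit.RiemannHypothesis.RiemannHypothesis.Theorems.Splittings.NbSparsity

open Literature.NumberTheory.LFunctions
open Summit.RiemannHypothesis.RiemannHypothesis.Theorems

/-! ## 5. Stability under ℓ¹-small perturbation of the coefficients -/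

/-- **Pointwise perturbation bound.** With `τ = Σ‖a_n - a'_n‖`, `w = 1/4+t²` and the tree's
critical-line bound `‖ζ(1/2+it)‖ ≤ 8(1+|t|)^{1/4}`:
`‖1-ζA'‖²/w ≤ 2·‖1-ζA‖²/w + τ²·2(1+8(1+|t|)^{1/4})²/w`. -/
theorem nbIntegrand_perturb_le {N : ℕ} (a a' : Fin N → ℂ) (t : ℝ) :
    ‖1 - riemannZeta (1 / 2 + t * Complex.I) *
        ∑ n : Fin N, a' n * ((n : ℂ) + 1) ^ (-(1 / 2 + t * Complex.I))‖ ^ 2 / (1 / 4 + t ^ 2) ≤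
      2 * (‖1 - riemannZeta (1 / 2 + t * Complex.I) *
        ∑ n : Fin N, a n * ((n : ℂ) + 1) ^ (-(1 / 2 + t * Complex.I))‖ ^ 2 / (1 / 4 + t ^ 2)) +
      (∑ n : Fin N, ‖a n - a' n‖) ^ 2 *
        (2 * ((1 + 8 * (1 + |t|) ^ (1 / 4 : ℝ)) ^ 2 / (1 / 4 + t ^ 2))) := by
  have hζ := norm_riemannZeta_half_line_le_eight_mul_rpow t
  set s : ℂ := 1 / 2 + t * Complex.I with hs
  set τ : ℝ := ∑ n : Fin N, ‖a n - a' n‖ with hτ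
  set r : ℝ := (1 + |t|) ^ (1 / 4 : ℝ) with hr
  have hτ0 : 0 ≤ τ := Finset.sum_nonneg fun n _ ↦ norm_nonneg _
  have hr0 : 0 ≤ r := by positivity
  have hsre : 0 ≤ s.re := by simp [hs]
  have hA : ∑ n : Fin N, a n * ((n : ℂ) + 1) ^ (-s) - ∑ n : Fin N, a' n * ((n : ℂ) + 1) ^ (-s) =
      dirichletPoly (a - a') s := by
    rw [dirichletPoly_apply, ← Finset.sum_sub_distrib]
    refine Finset.sum_congr rfl fun n _ ↦ ?_
    rw [Pi.sub_apply, sub_mul]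
  have hdiff : ‖∑ n : Fin N, a n * ((n : ℂ) + 1) ^ (-s) -
      ∑ n : Fin N, a' n * ((n : ℂ) + 1) ^ (-s)‖ ≤ τ := by
    rw [hA]
    have h := norm_dirichletPoly_le (a - a') hsre
    simpa [Pi.sub_apply] using h
  set x : ℝ := ‖1 - riemannZeta s * ∑ n : Fin N, a n * ((n : ℂ) + 1) ^ (-s)‖ with hx
  have hx0 : 0 ≤ x := norm_nonneg _
  have hkey : ‖1 - riemannZeta s * ∑ n : Fin N, a' n * ((n : ℂ) + 1) ^ (-s)‖ ≤ x + 8 * r * τ := by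
    have e : 1 - riemannZeta s * ∑ n : Fin N, a' n * ((n : ℂ) + 1) ^ (-s) =
        (1 - riemannZeta s * ∑ n : Fin N, a n * ((n : ℂ) + 1) ^ (-s)) +
        riemannZeta s * (∑ n : Fin N, a n * ((n : ℂ) + 1) ^ (-s) -
          ∑ n : Fin N, a' n * ((n : ℂ) + 1) ^ (-s)) := by ring
    rw [e]
    calc ‖(1 - riemannZeta s * ∑ n : Fin N, a n * ((n : ℂ) + 1) ^ (-s)) +
          riemannZeta s * (∑ n : Fin N, a n * ((n : ℂ) + 1) ^ (-s) -
            ∑ n : Fin N, a' n * ((n : ℂ) + 1) ^ (-s))‖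
        ≤ x + ‖riemannZeta s * (∑ n : Fin N, a n * ((n : ℂ) + 1) ^ (-s) -
            ∑ n : Fin N, a' n * ((n : ℂ) + 1) ^ (-s))‖ := norm_add_le _ _
      _ = x + ‖riemannZeta s‖ * ‖∑ n : Fin N, a n * ((n : ℂ) + 1) ^ (-s) -
            ∑ n : Fin N, a' n * ((n : ℂ) + 1) ^ (-s)‖ := by rw [norm_mul]
      _ ≤ x + (8 * r) * τ := by gcongr
      _ = x + 8 * r * τ := by ring
  have h0 : 0 ≤ ‖1 - riemannZeta s * ∑ n : Fin N, a' n * ((n : ℂ) + 1) ^ (-s)‖ := norm_nonneg _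
  have hsq1 : ‖1 - riemannZeta s * ∑ n : Fin N, a' n * ((n : ℂ) + 1) ^ (-s)‖ ^ 2 ≤
      (x + 8 * r * τ) ^ 2 := pow_le_pow_left₀ h0 hkey 2
  have hsq : ‖1 - riemannZeta s * ∑ n : Fin N, a' n * ((n : ℂ) + 1) ^ (-s)‖ ^ 2 ≤
      2 * x ^ 2 + τ ^ 2 * (2 * (1 + 8 * r) ^ 2) := by
    have hrt : 0 ≤ r * τ ^ 2 := mul_nonneg hr0 (sq_nonneg τ)
    nlinarith [hsq1, sq_nonneg (x - 8 * r * τ), hrt]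
  have hw : 0 < 1 / 4 + t ^ 2 := by positivity
  calc ‖1 - riemannZeta s * ∑ n : Fin N, a' n * ((n : ℂ) + 1) ^ (-s)‖ ^ 2 / (1 / 4 + t ^ 2)
      ≤ (2 * x ^ 2 + τ ^ 2 * (2 * (1 + 8 * r) ^ 2)) / (1 / 4 + t ^ 2) :=
        div_le_div_of_nonneg_right hsq hw.le
    _ = 2 * (x ^ 2 / (1 / 4 + t ^ 2)) + τ ^ 2 * (2 * ((1 + 8 * r) ^ 2 / (1 / 4 + t ^ 2))) := by
        ring

/-- **Integrated perturbation bound.** `I(N,a') ≤ 2·I(N,a) + 2τ²K` with `τ = Σ‖a_n - a'_n‖` and the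
finite constant `K = ∫(1+8(1+|t|)^{1/4})²/(1/4+t²) dt` (`integrable_nbMajorant 8`). -/
theorem nb_lintegral_perturb_le {N : ℕ} (a a' : Fin N → ℂ) :
    ∫⁻ t : ℝ, ENNReal.ofReal (‖1 - riemannZeta (1 / 2 + t * Complex.I) *
        ∑ n : Fin N, a' n * ((n : ℂ) + 1) ^ (-(1 / 2 + t * Complex.I))‖ ^ 2 / (1 / 4 + t ^ 2)) ≤
      (2 * ∫⁻ t : ℝ, ENNReal.ofReal (‖1 - riemannZeta (1 / 2 + t * Complex.I) *
        ∑ n : Fin N, a n * ((n : ℂ) + 1) ^ (-(1 / 2 + t * Complex.I))‖ ^ 2 / (1 / 4 + t ^ 2))) +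
      ENNReal.ofReal (2 * (∑ n : Fin N, ‖a n - a' n‖) ^ 2 *
        ∫ t : ℝ, (1 + 8 * (1 + |t|) ^ (1 / 4 : ℝ)) ^ 2 / (1 / 4 + t ^ 2)) := by
  set τ : ℝ := ∑ n : Fin N, ‖a n - a' n‖ with hτ
  have h1 : ∫⁻ t : ℝ, ENNReal.ofReal (‖1 - riemannZeta (1 / 2 + t * Complex.I) *
        ∑ n : Fin N, a' n * ((n : ℂ) + 1) ^ (-(1 / 2 + t * Complex.I))‖ ^ 2 / (1 / 4 + t ^ 2)) ≤
      ∫⁻ t : ℝ, (ENNReal.ofReal (2 * (‖1 - riemannZeta (1 / 2 + t * Complex.I) *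
        ∑ n : Fin N, a n * ((n : ℂ) + 1) ^ (-(1 / 2 + t * Complex.I))‖ ^ 2 / (1 / 4 + t ^ 2))) +
        ENNReal.ofReal (τ ^ 2 * (2 * ((1 + 8 * (1 + |t|) ^ (1 / 4 : ℝ)) ^ 2 / (1 / 4 + t ^ 2))))) := by
    refine lintegral_mono fun t ↦ ?_
    exact (ENNReal.ofReal_le_ofReal (nbIntegrand_perturb_le a a' t)).trans ENNReal.ofReal_add_le
  have hmeas : Measurable fun t : ℝ ↦ ENNReal.ofReal (2 * (‖1 - riemannZeta (1 / 2 + t * Complex.I) *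
      ∑ n : Fin N, a n * ((n : ℂ) + 1) ^ (-(1 / 2 + t * Complex.I))‖ ^ 2 / (1 / 4 + t ^ 2))) :=
    (continuous_const.mul (continuous_nbIntegrand a)).measurable.ennreal_ofReal
  rw [lintegral_add_left hmeas] at h1
  have h2 : ∫⁻ t : ℝ, ENNReal.ofReal (2 * (‖1 - riemannZeta (1 / 2 + t * Complex.I) *
        ∑ n : Fin N, a n * ((n : ℂ) + 1) ^ (-(1 / 2 + t * Complex.I))‖ ^ 2 / (1 / 4 + t ^ 2))) =
      2 * ∫⁻ t : ℝ, ENNReal.ofReal (‖1 - riemannZeta (1 / 2 + t * Complex.I) *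
        ∑ n : Fin N, a n * ((n : ℂ) + 1) ^ (-(1 / 2 + t * Complex.I))‖ ^ 2 / (1 / 4 + t ^ 2)) := by
    rw [← lintegral_const_mul' 2 _ ENNReal.ofNat_ne_top]
    refine lintegral_congr fun t ↦ ?_
    rw [ENNReal.ofReal_mul (by norm_num : (0 : ℝ) ≤ 2), ENNReal.ofReal_ofNat]
  have hint : Integrable fun t : ℝ ↦ τ ^ 2 * (2 * ((1 + 8 * (1 + |t|) ^ (1 / 4 : ℝ)) ^ 2 / (1 / 4 + t ^ 2))) :=
    ((integrable_nbMajorant 8).const_mul 2).const_mul (τ ^ 2)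
  have h3 : ∫⁻ t : ℝ, ENNReal.ofReal (τ ^ 2 * (2 * ((1 + 8 * (1 + |t|) ^ (1 / 4 : ℝ)) ^ 2 / (1 / 4 + t ^ 2)))) =
      ENNReal.ofReal (2 * τ ^ 2 * ∫ t : ℝ, (1 + 8 * (1 + |t|) ^ (1 / 4 : ℝ)) ^ 2 / (1 / 4 + t ^ 2)) := by
    rw [← ofReal_integral_eq_lintegral_ofReal hint (Eventually.of_forall fun t ↦ by positivity)]
    congr 1
    rw [integral_const_mul, integral_const_mul]
    ring
  rw [h2, h3] at h1
  exact h1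

/-! ## 6. V35 refuted as an open condition: no ℓ¹-near-sparse Nyman–Beurling approximation -/

/-- **NEAR-SPARSE(B) refuted, for every `B`.**  It is NOT the case that for every `ε > 0` some
Dirichlet polynomial whose coefficient mass outside some `B`-set is `< ε` has Nyman–Beurling
integral `< ε`: truncation to the `B`-set costs `≤ 2I + 2ε²K` (`nb_lintegral_perturb_le`), and
exactly `B`-sparse approximants are refuted (`not_nbSparseApprox`). -/
theorem not_nbNearSparseApprox (B : ℕ) :
    ¬ ∀ ε : ℝ, 0 < ε → ∃ (N : ℕ) (a : Fin N → ℂ) (S : Finset (Fin N)),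
      S.card ≤ B ∧ ∑ n ∈ Sᶜ, ‖a n‖ < ε ∧
      ∫⁻ t : ℝ, ENNReal.ofReal (‖1 - riemannZeta (1 / 2 + t * Complex.I) *
        ∑ n : Fin N, a n * ((n : ℂ) + 1) ^ (-(1 / 2 + t * Complex.I))‖ ^ 2 / (1 / 4 + t ^ 2)) <
        ENNReal.ofReal ε := by
  intro H
  refine not_nbSparseApprox B fun ε₀ hε₀ ↦ ?_
  set K : ℝ := ∫ t : ℝ, (1 + 8 * (1 + |t|) ^ (1 / 4 : ℝ)) ^ 2 / (1 / 4 + t ^ 2) with hK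
  have hK0 : 0 ≤ K := integral_nonneg fun t ↦ by positivity
  set ε : ℝ := min 1 (ε₀ / (4 * (1 + K))) with hε
  have hε0 : 0 < ε := lt_min one_pos (by positivity)
  have hε1 : ε ≤ 1 := min_le_left _ _
  have hεK : ε ≤ ε₀ / (4 * (1 + K)) := min_le_right _ _
  obtain ⟨N, a, S, hS, hmass, hI⟩ := H ε hε0
  set a' : Fin N → ℂ := fun n ↦ if n ∈ S then a n else 0 with ha'
  refine ⟨N, a', ?_, ?_⟩
  · calc (Finset.univ.filter (fun n => a' n ≠ 0)).card ≤ S.card := by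
          refine Finset.card_le_card fun n hn ↦ ?_
          rw [Finset.mem_filter] at hn
          by_contra hnS
          exact hn.2 (by simp [ha', hnS])
      _ ≤ B := hS
  · have hτ : ∑ n : Fin N, ‖a n - a' n‖ = ∑ n ∈ Sᶜ, ‖a n‖ := by
      rw [← Finset.sum_add_sum_compl S]
      have h1 : ∑ n ∈ S, ‖a n - a' n‖ = 0 :=
        Finset.sum_eq_zero fun n hn ↦ by simp [ha', hn]
      have h2 : ∑ n ∈ Sᶜ, ‖a n - a' n‖ = ∑ n ∈ Sᶜ, ‖a n‖ :=
        Finset.sum_congr rfl fun n hn ↦ by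
          rw [Finset.mem_compl] at hn
          simp [ha', hn]
      rw [h1, h2, zero_add]
    have hP := nb_lintegral_perturb_le a a'
    rw [hτ] at hP
    refine lt_of_le_of_lt hP ?_
    have hm0 : 0 ≤ ∑ n ∈ Sᶜ, ‖a n‖ := Finset.sum_nonneg fun n _ ↦ norm_nonneg _
    have hm2 : (∑ n ∈ Sᶜ, ‖a n‖) ^ 2 ≤ ε := by nlinarith
    have h2I : 2 * ∫⁻ t : ℝ, ENNReal.ofReal (‖1 - riemannZeta (1 / 2 + t * Complex.I) *
        ∑ n : Fin N, a n * ((n : ℂ) + 1) ^ (-(1 / 2 + t * Complex.I))‖ ^ 2 / (1 / 4 + t ^ 2)) ≤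
        ENNReal.ofReal (2 * ε) := by
      rw [ENNReal.ofReal_mul (by norm_num : (0 : ℝ) ≤ 2), ENNReal.ofReal_ofNat]
      exact mul_le_mul_right hI.le 2
    have hKε : ENNReal.ofReal (2 * (∑ n ∈ Sᶜ, ‖a n‖) ^ 2 * K) ≤ ENNReal.ofReal (2 * ε * K) :=
      ENNReal.ofReal_le_ofReal (mul_le_mul_of_nonneg_right (by linarith) hK0)
    calc (2 * ∫⁻ t : ℝ, ENNReal.ofReal (‖1 - riemannZeta (1 / 2 + t * Complex.I) *
          ∑ n : Fin N, a n * ((n : ℂ) + 1) ^ (-(1 / 2 + t * Complex.I))‖ ^ 2 / (1 / 4 + t ^ 2))) +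
          ENNReal.ofReal (2 * (∑ n ∈ Sᶜ, ‖a n‖) ^ 2 * K)
        ≤ ENNReal.ofReal (2 * ε) + ENNReal.ofReal (2 * ε * K) := add_le_add h2I hKε
      _ = ENNReal.ofReal (2 * ε + 2 * ε * K) :=
          (ENNReal.ofReal_add (by positivity) (by positivity)).symm
      _ < ENNReal.ofReal ε₀ := by
          rw [ENNReal.ofReal_lt_ofReal_iff hε₀]
          have h4 : ε * (4 * (1 + K)) ≤ ε₀ := by rwa [le_div_iff₀ (by positivity)] at hεK
          nlinarith [mul_nonneg hε0.le hK0]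

/-- **Near-sparsity floor (positive form).** For every `B` there is `ε(B) > 0` such that every
Dirichlet polynomial whose coefficient mass outside some `B`-set is `< ε(B)` has Nyman–Beurling
integral `≥ ε(B)`. -/
theorem nbNearSparse_floor (B : ℕ) :
    ∃ ε : ℝ, 0 < ε ∧ ∀ (N : ℕ) (a : Fin N → ℂ) (S : Finset (Fin N)),
      S.card ≤ B → ∑ n ∈ Sᶜ, ‖a n‖ < ε →
      ENNReal.ofReal ε ≤ ∫⁻ t : ℝ, ENNReal.ofReal (‖1 - riemannZeta (1 / 2 + t * Complex.I) *
        ∑ n : Fin N, a n * ((n : ℂ) + 1) ^ (-(1 / 2 + t * Complex.I))‖ ^ 2 / (1 / 4 + t ^ 2)) := by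
  by_contra h
  push Not at h
  exact not_nbNearSparseApprox B h

end Summit.RiemannHypothesis.RiemannHypothesis.Theorems.Splittings.NbSparsity
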